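import Literature.NumberTheory.GelbartRogawski1991.LocalDoubledDiagonalEigenlaw
import Literature.NumberTheory.Automorphic.UnitaryGroupDualPairCarriers
import Literature.NumberTheory.Automorphic.UnitaryGroupFinAdelicCenterLocal
import HarnessLib

/-!
# The Kronecker embedding `ι : U(W ⊕ −W)(F_v) → U(V ⊕ −V)(F_v)`, `h ↦ h ⊗ 1_V`, of the rank-one doubled unitary group
# into the doubled group of a hermitian space `V` of rank `m`: `P_Δ` is preserved and `det_Δ ∘ ι = det_Δ ^ m`

Topic `NumberTheory/GelbartRogawski1991`; namespace `Literature.NumberTheory.GelbartRogawski1991.UnitaryDualPair.LocalSplitting`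
(that of ★ `LocalDoubledUnitaryDatum` ∕ `LocalDoubledUnitarySiegel` ∕ `LocalUnitaryBlockRestriction` ∕ `LocalDoubledDiagonalEigenlaw`).
KERNEL MATHEMATICS: four definitions with bodies (`eKron`, `kronOneGL`, `kronOneInl`, `kronLoc`) and theorems; no named fact, no
`sorry`, no instance, no notation.

Setting: `E/F` quadratic with conjugation `c` (CM data `(δ, d)`), a finite place `v`, a symmetric `T ∈ M_m(F)` (a hermitian space
`V = T ⊗ 1` of rank `m`), `J = T ⊗ 1`, the doubled Gram matrices `J^𝔻 = (T ⊕ −T) ⊗ 1 ∈ M_{m+m}(E)` (★ `gramD F m T`) and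
`J^𝔻_1 = (1 ⊕ −1) ⊗ 1 ∈ M_{1+1}(E)` (★ `gramD F 1 1`, the STANDARD rank-one doubled line `W ⊕ −W`, `W = ⟨1⟩`), the doubled groups
`H = U(V ⊕ −V)(F_v) = localPi E c (m+m) J^𝔻 v` and `G₁ = U(W ⊕ −W)(F_v) = localPi E c (1+1) J^𝔻_1 v`.  Since
`V ⊕ −V = (W ⊕ −W) ⊗ V` isometrically — `reindex (J^𝔻_1 ⊗ₖ J) = J^𝔻` on the nose for the enumeration `eKron m : Fin (1+1) × Fin m ≃ Fin (m+m)`,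
`(e₂ 1 (inl 0), i) ↦ e₂ m (inl i)`, `(e₂ 1 (inr 0), i) ↦ e₂ m (inr i)` (`reindex_eKron_gramD_one_kronecker`) — the Kronecker product
`h ↦ h ⊗ₖ 1_V` is a homomorphism `ι : G₁ →* H`:

* §0 `eKron` and the block dictionary `reindex (eKron m) (A ⊗ₖ B) = reindex (e₂ m) (fromBlocks (a₀₀ • B) (a₀₁ • B) (a₁₀ • B) (a₁₁ • B))`
  (`reindex_eKron_kronecker`; `a_{bb′}` the entries of the `(1+1)`-matrix `A` in the `e₂ 1`-enumeration);
* §1 the generic local factor map `kronOneGL : Π_{w∣v} GL_N(E_w) →* Π_{w∣v} GL_n(E_w)`, `(k_w) ↦ (reindex e (k_w ⊗ₖ 1_m))_w`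
  (`e : Fin N × Fin m ≃ Fin n`; the `m = 1` case is ★ `localLineGL`), its unitarity `kronOneGL_mem` (`(c_*(k ⊗ 1))ᵀ (J_V ⊗ J_W) (k ⊗ 1) =
  ((c_* k)ᵀ J_V k) ⊗ J_W`), the homomorphism `kronOneInl : localPi E c N J_V v →* localPi E c n (reindex e e (J_V ⊗ₖ J_W)) v` and its continuity;
* §2 **`kronLoc : G₁ →* H`, `h ↦ h ⊗ 1_V`** (`kronOneInl` at `e = eKron m`, `J_V = J^𝔻_1`, `J_W = J`, read on `localPi … J^𝔻 v` through the matrix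
  identity of §0), components `coe_kronLoc_apply`, blocks `reindex_symm_kronLoc` (`= fromBlocks (h₀₀ • 1) (h₀₁ • 1) (h₁₀ • 1) (h₁₁ • 1)`),
  continuity `continuous_kronLoc`;
* §3 **Siegel compatibility**: `deltaBlock (ι h) = (h₀₀ + h₀₁) • 1_m` (`deltaBlock_kronLoc`), **`detDelta (ι h) = (detDelta h) ^ m`**
  (`detDelta_kronLoc`, with `detDelta h = h₀₀ + h₀₁` in rank one, `detDelta_one_eq_entries`), and **`IsSiegelDelta (ι h) ↔ IsSiegelDelta h`** for
  `m ≠ 0` (`isSiegelDelta_kronLoc_iff`; in particular `ι(P_Δ^{(1)}) ⊆ P_Δ^{(m)}`, `IsSiegelDelta.kronLoc`);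
* §4 **compatibility with the block embeddings and the local centres**: `ι (z ⊕ z′) = (z·1_V) ⊕ (z′·1_V)`, i.e.
  `kronLoc (inlLoc z * inrLoc z′) = inlLoc (localCenter z) * inrLoc (localCenter z′)` read componentwise
  (`kronLoc_inlLoc_mul_inrLoc_apply`: both sides are `reindex (e₂ m) (fromBlocks (z₀₀ • 1) 0 0 (z′₀₀ • 1))`), so `ι(U(W) × U(−W))`
  acts through the centres `Z(U(V)) × Z(U(−V))`;
* §5 **`ι(G₁)` centralises the diagonal `U(V)`** (`kronLoc_mul_diagD_comm`: `ι h · i(g,g) = i(g,g) · ι h`, ★ B1 `diagD`; the see-saw pair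
  `U(W ⊕ −W) × U(V) ⊂ U((W ⊕ −W) ⊗ V)` commutes).

USE (cell hodgecm-mathlib, half A line LD2, brick (K) «KRONECKER» of LD2-plan (g2)'s RULING (β) 2026-09-02, soft road (π3) to the pin (P) of
[Liu2021, Lem. D.1 (1)]; consumer B-p04 (g44)'s (J1) junction): with `m = 2`, `V` the letter's anisotropic plane, the `Δ`-functional `λ′` of `H`
(★ `apply_zero_toRep_mul_localSplitting_eq_mul`, eigencharacter `χ_v(det_Δ) · ∏_w ‖det_Δ‖_w^{1∕2}` on `P_Δ(H)`) pulled back along `ι` has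
eigencharacter `χ_v((det_Δ h)²) · ‖det_Δ h‖_w^{2∕2}` on `P_Δ(G₁)` (§3) — the FULL power `‖det_Δ‖ = Δ_{P_Δ}` (★ «Siegel = Borel transport»), so
`h ↦ λ′(ω(s′(ι h)) Φ)` is a `Δ_{P_Δ}`-density of `G₁` and ★ `LocalDoubledInvariantFunctional.exists_rightInvariant_functional_of_isSiegelDelta_cm`
applies.  HONEST LABEL: elementary matrix bookkeeping, nothing of [Liu2021] asserted; HC_CM is proved only modulo the 7 printed citations
(2 remaining: hLiu418 = stmt-HodgeConjecture-24832, h413 = stmt-HodgeConjecture-24833) until rung 0 closes; count-neutral.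

## References
* [Kudla1984] S. Kudla, *Seesaw dual reductive pairs*, Progr. Math. 46 (1984), §1 (see-saw pairs in `Sp(𝕎 ⊗ (W ⊕ −W))`).
* [Kudla1994] S. S. Kudla, Israel J. Math. 87 (1994) 361–401, §2–§3 (doubled space, Siegel parabolic, `x(p) = det_Δ`).
* [MoeglinVignerasWaldspurger1987] C. Mœglin, M.-F. Vignéras, J.-L. Waldspurger, LNM 1291 (1987), Chap. 1 I.17 (dual pairs `U(V) × U(W′) → U(V ⊗ W′)`).
* [HarrisKudlaSweet1996] M. Harris, S. S. Kudla, W. J. Sweet, J. Amer. Math. Soc. 9 (1996), §1 (1.9)–(1.16).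
* [GelbartRogawski1991] S. Gelbart, J. Rogawski, Invent. Math. 105 (1991), §3.1–§3.2.
-/

set_option autoImplicit false

noncomputable section

open scoped Matrix Kronecker
open NumberField IsDedekindDomain Matrix
open Literature.NumberTheory.Automorphic Literature.NumberTheory.Automorphic.UnitaryGroup

namespace Literature.NumberTheory.GelbartRogawski1991.UnitaryDualPair.LocalSplitting

/-! ## §0 The enumeration `eKron m : Fin (1+1) × Fin m ≃ Fin (m+m)` and the block dictionary of `A ⊗ₖ B` -/

/-- **the enumeration `(W ⊕ −W) ⊗ V = V ⊕ V`**: `(e₂ 1 (inl 0), i) ↦ e₂ m (inl i)`, `(e₂ 1 (inr 0), i) ↦ e₂ m (inr i)`.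
[cite: Kudla1984, §1] -/
def eKron (m : ℕ) : Fin (1 + 1) × Fin m ≃ Fin (m + m) :=
  ((Equiv.prodCongr (e₂ 1).symm (Equiv.refl (Fin m))).trans (Equiv.sumProdDistrib (Fin 1) (Fin 1) (Fin m))).trans
    ((Equiv.sumCongr (Equiv.uniqueProd (Fin m) (Fin 1)) (Equiv.uniqueProd (Fin m) (Fin 1))).trans (e₂ m))

/-- `eKron m (e₂ 1 (inl 0), i) = e₂ m (inl i)`. [cite: Kudla1984, §1] -/
@[simp] theorem eKron_apply_inl (m : ℕ) (i : Fin m) : eKron m (e₂ 1 (Sum.inl 0), i) = e₂ m (Sum.inl i) := by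
  simp [eKron]

/-- `eKron m (e₂ 1 (inr 0), i) = e₂ m (inr i)`. [cite: Kudla1984, §1] -/
@[simp] theorem eKron_apply_inr (m : ℕ) (i : Fin m) : eKron m (e₂ 1 (Sum.inr 0), i) = e₂ m (Sum.inr i) := by
  simp [eKron]

/-- `(eKron m)⁻¹ (e₂ m (inl i)) = (e₂ 1 (inl 0), i)`. [cite: Kudla1984, §1] -/
@[simp] theorem eKron_symm_apply_inl (m : ℕ) (i : Fin m) : (eKron m).symm (e₂ m (Sum.inl i)) = (e₂ 1 (Sum.inl 0), i) := by
  rw [Equiv.symm_apply_eq, eKron_apply_inl]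

/-- `(eKron m)⁻¹ (e₂ m (inr i)) = (e₂ 1 (inr 0), i)`. [cite: Kudla1984, §1] -/
@[simp] theorem eKron_symm_apply_inr (m : ℕ) (i : Fin m) : (eKron m).symm (e₂ m (Sum.inr i)) = (e₂ 1 (Sum.inr 0), i) := by
  rw [Equiv.symm_apply_eq, eKron_apply_inr]

/-- **the block dictionary**: `reindex (eKron m) (A ⊗ₖ B) = reindex (e₂ m) (fromBlocks (a₀₀ • B) (a₀₁ • B) (a₁₀ • B) (a₁₁ • B))`, `a_{bb′}` the
entries of `A` in the `e₂ 1`-enumeration. [cite: Kudla1984, §1] -/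
theorem reindex_eKron_kronecker {R : Type*} [CommRing R] (m : ℕ) (A : Matrix (Fin (1 + 1)) (Fin (1 + 1)) R) (B : Matrix (Fin m) (Fin m) R) :
    Matrix.reindex (eKron m) (eKron m) (A ⊗ₖ B) =
      Matrix.reindex (e₂ m) (e₂ m)
        (Matrix.fromBlocks (A (e₂ 1 (Sum.inl 0)) (e₂ 1 (Sum.inl 0)) • B) (A (e₂ 1 (Sum.inl 0)) (e₂ 1 (Sum.inr 0)) • B)
          (A (e₂ 1 (Sum.inr 0)) (e₂ 1 (Sum.inl 0)) • B) (A (e₂ 1 (Sum.inr 0)) (e₂ 1 (Sum.inr 0)) • B)) := by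
  ext x y
  obtain ⟨sx, rfl⟩ := (e₂ m).surjective x
  obtain ⟨sy, rfl⟩ := (e₂ m).surjective y
  rcases sx with i | i <;> rcases sy with j | j <;>
    simp only [Matrix.reindex_apply, Matrix.submatrix_apply, Equiv.symm_apply_apply, eKron_symm_apply_inl,
      eKron_symm_apply_inr, Matrix.kroneckerMap_apply, Matrix.fromBlocks_apply₁₁, Matrix.fromBlocks_apply₁₂,
      Matrix.fromBlocks_apply₂₁, Matrix.fromBlocks_apply₂₂, Matrix.smul_apply, smul_eq_mul]

/-- the entries of the rank-one doubled Gram matrix `1 ⊕ −1` in the `e₂ 1`-enumeration. [cite: Kudla1994, §2] -/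
theorem gramD_one_apply (F : Type) [Field F] :
    gramD F 1 1 (e₂ 1 (Sum.inl 0)) (e₂ 1 (Sum.inl 0)) = 1 ∧ gramD F 1 1 (e₂ 1 (Sum.inl 0)) (e₂ 1 (Sum.inr 0)) = 0 ∧
      gramD F 1 1 (e₂ 1 (Sum.inr 0)) (e₂ 1 (Sum.inl 0)) = 0 ∧ gramD F 1 1 (e₂ 1 (Sum.inr 0)) (e₂ 1 (Sum.inr 0)) = -1 := by
  refine ⟨?_, ?_, ?_, ?_⟩ <;>
    simp only [gramD, Matrix.reindex_apply, Matrix.submatrix_apply, Equiv.symm_apply_apply, Matrix.fromBlocks_apply₁₁,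
      Matrix.fromBlocks_apply₁₂, Matrix.fromBlocks_apply₂₁, Matrix.fromBlocks_apply₂₂, Matrix.one_apply_eq, Matrix.zero_apply,
      Matrix.neg_apply]

/-- **`(W ⊕ −W) ⊗ V = V ⊕ −V` on Gram matrices**: `reindex (eKron m) (J^𝔻_1 ⊗ₖ J) = J^𝔻` for `J = T ⊗ 1`, `J^𝔻_1 = (1 ⊕ −1) ⊗ 1`,
`J^𝔻 = (T ⊕ −T) ⊗ 1`. [cite: Kudla1984, §1] [cite: Kudla1994, §2] -/
theorem reindex_eKron_gramD_one_kronecker (F : Type) [Field F] (E : Type) [Field E] [Algebra F E] (m : ℕ) (T : Matrix (Fin m) (Fin m) F) :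
    Matrix.reindex (eKron m) (eKron m) (((gramD F 1 1).map (algebraMap F E)) ⊗ₖ (T.map (algebraMap F E))) =
      (gramD F m T).map (algebraMap F E) := by
  obtain ⟨h₁, h₂, h₃, h₄⟩ := gramD_one_apply F
  rw [reindex_eKron_kronecker]
  simp only [Matrix.map_apply, h₁, h₂, h₃, h₄, map_one, map_zero, map_neg, one_smul, zero_smul, neg_smul]
  rw [gramD, UnitaryGroup.reindex_map, Matrix.fromBlocks_map, Matrix.map_zero _ (map_zero _),
    Matrix.map_neg _ (map_neg (algebraMap F E))]

/-! ## §1 `k ↦ reindex e (k ⊗ₖ 1_m)` on the local factors (the `m = 1` case is ★ `localLineGL` ∕ `localLineInl`) -/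

section KronOne

variable (E : Type) [Field E] [NumberField E]

/-- `(k_w)_w ↦ (reindex e (k_w ⊗ₖ 1_m))_w` on `Π_{w ∣ v} GL_N(E_w) → Π_{w ∣ v} GL_n(E_w)`. [cite: MoeglinVignerasWaldspurger1987, Chap. 1 I.17] -/
def kronOneGL (N m : ℕ) {n : ℕ} (e : Fin N × Fin m ≃ Fin n) {F : Type} [Field F] [NumberField F] [Algebra F E]
    (v : HeightOneSpectrum (𝓞 F)) : LocalGLPi E N v →* LocalGLPi E n v where
  toFun k w := UnitaryGroup.reindexGL e (kroneckerGL (k w, (1 : GL (Fin m) (w.1.adicCompletion E))))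
  map_one' := funext fun w => by rw [Pi.one_apply, Pi.one_apply, ← Prod.one_eq_mk, map_one, map_one]
  map_mul' k k' := funext fun w => by rw [Pi.mul_apply, Pi.mul_apply, ← map_mul, ← map_mul, Prod.mk_mul_mk, mul_one]

/-- matrix of the `w`-component: `reindex e e (k_w ⊗ₖ 1)`. [cite: MoeglinVignerasWaldspurger1987, Chap. 1 I.17] -/
theorem coe_kronOneGL_apply (N m : ℕ) {n : ℕ} (e : Fin N × Fin m ≃ Fin n) {F : Type} [Field F] [NumberField F] [Algebra F E]
    (v : HeightOneSpectrum (𝓞 F)) (k : LocalGLPi E N v) (w : PlacesOver E v) :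
    ((kronOneGL E N m e v k w : GL (Fin n) (w.1.adicCompletion E)) : Matrix (Fin n) (Fin n) (w.1.adicCompletion E)) =
      Matrix.reindex e e (((k w : GL (Fin N) (w.1.adicCompletion E)) : Matrix (Fin N) (Fin N) (w.1.adicCompletion E)) ⊗ₖ
        (1 : Matrix (Fin m) (Fin m) (w.1.adicCompletion E))) := by
  rw [show kronOneGL E N m e v k w = UnitaryGroup.reindexGL e (kroneckerGL (k w, 1)) from rfl, UnitaryGroup.coe_reindexGL,
    coe_kroneckerGL, Units.val_one]

/-- `kronOneGL` is continuous. [cite: MoeglinVignerasWaldspurger1987, Chap. 1 I.17] -/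
theorem continuous_kronOneGL (N m : ℕ) {n : ℕ} (e : Fin N × Fin m ≃ Fin n) {F : Type} [Field F] [NumberField F] [Algebra F E]
    (v : HeightOneSpectrum (𝓞 F)) : Continuous (kronOneGL E N m e v) :=
  continuous_pi fun w => (UnitaryGroup.continuous_reindexGL e).comp
    (continuous_kroneckerGL.comp (((continuous_apply w).prodMk continuous_const)))

/-- the form of `V ⊗ W′` at `w` (any sizes): `placeForm (reindex e e (J_V ⊗ₖ J_W)) w = reindex e e (placeForm J_V w ⊗ₖ placeForm J_W w)`
(the `Fin 1` case is ★ `placeForm_reindex_kronecker`). [cite: GelbartRogawski1991, §3.1 p. 454] -/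
theorem placeForm_reindex_kronecker_general (N m : ℕ) {n : ℕ} (e : Fin N × Fin m ≃ Fin n)
    (JV : Matrix (Fin N) (Fin N) E) (JW : Matrix (Fin m) (Fin m) E) (w : HeightOneSpectrum (𝓞 E)) :
    placeForm (Matrix.reindex e e (JV ⊗ₖ JW)) w = Matrix.reindex e e (placeForm JV w ⊗ₖ placeForm JW w) := by
  rw [placeForm, placeForm, placeForm, kronecker_map_map]
  rfl

/-- the unitarity expression of `reindex e (k ⊗ 1_m)` at `w` is `reindex e (((c_* k)ᵀ J_V k) ⊗ J_W)`:
`(c_*(k ⊗ 1))ᵀ (J_V ⊗ J_W) (k ⊗ 1) = ((c_* k)ᵀ J_V k) ⊗ (1ᵀ J_W 1)`. [cite: MoeglinVignerasWaldspurger1987, Chap. 1 I.17] -/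
theorem kronOneGL_form (N m : ℕ) {n : ℕ} (e : Fin N × Fin m ≃ Fin n) {F : Type} [Field F] [NumberField F] [Algebra F E]
    (c : E ≃ₐ[F] E) (JV : Matrix (Fin N) (Fin N) E) (JW : Matrix (Fin m) (Fin m) E)
    (v : HeightOneSpectrum (𝓞 F)) (k : LocalGLPi E N v) (w : PlacesOver E v) :
    (((kronOneGL E N m e v k (PlacesOver.galInv c w) : GL (Fin n) ((PlacesOver.galInv c w).1.adicCompletion E)) :
            Matrix (Fin n) (Fin n) ((PlacesOver.galInv c w).1.adicCompletion E)).map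
          (galAdicCompletionMap c (smul_inv_smul c w.1)))ᵀ * placeForm (Matrix.reindex e e (JV ⊗ₖ JW)) w.1 *
        ((kronOneGL E N m e v k w : GL (Fin n) (w.1.adicCompletion E)) : Matrix (Fin n) (Fin n) (w.1.adicCompletion E)) =
      Matrix.reindex e e
        (((((k (PlacesOver.galInv c w) : GL (Fin N) ((PlacesOver.galInv c w).1.adicCompletion E)) :
                Matrix (Fin N) (Fin N) ((PlacesOver.galInv c w).1.adicCompletion E)).map
              (galAdicCompletionMap c (smul_inv_smul c w.1)))ᵀ * placeForm JV w.1 *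
            ((k w : GL (Fin N) (w.1.adicCompletion E)) : Matrix (Fin N) (Fin N) (w.1.adicCompletion E))) ⊗ₖ
          placeForm JW w.1) := by
  rw [coe_kronOneGL_apply, coe_kronOneGL_apply, placeForm_reindex_kronecker_general, Matrix.reindex_apply,
    Matrix.reindex_apply, Matrix.reindex_apply, Matrix.reindex_apply, ← Matrix.submatrix_map, Matrix.transpose_submatrix,
    ← kronecker_map_map, kronecker_transpose, Matrix.map_one _ (map_zero _) (map_one _), Matrix.transpose_one,
    Matrix.submatrix_mul_equiv,
    Matrix.submatrix_mul_equiv, ← Matrix.mul_kronecker_mul, ← Matrix.mul_kronecker_mul, Matrix.one_mul, Matrix.mul_one]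

/-- **`reindex e (k ⊗ 1_m) ∈ U(J_V ⊗ J_W)(F_v)` for `k ∈ U(J_V)(F_v)`** (any `J_W ∈ M_m(E)`). [cite: MoeglinVignerasWaldspurger1987, Chap. 1 I.17] -/
theorem kronOneGL_mem (N m : ℕ) {n : ℕ} (e : Fin N × Fin m ≃ Fin n) {F : Type} [Field F] [NumberField F] [Algebra F E]
    (c : E ≃ₐ[F] E) (JV : Matrix (Fin N) (Fin N) E) (JW : Matrix (Fin m) (Fin m) E)
    (v : HeightOneSpectrum (𝓞 F)) (k : localPi E c N JV v) :
    kronOneGL E N m e v (k : LocalGLPi E N v) ∈ localPi E c n (Matrix.reindex e e (JV ⊗ₖ JW)) v := by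
  rw [mem_localPi_iff]
  intro w
  rw [kronOneGL_form, (mem_localPi_iff E c N JV v (k : LocalGLPi E N v)).1 k.2 w, placeForm_reindex_kronecker_general]

/-- **`kronOneInl … v : U(J_V)(F_v) →* U(J_V ⊗ J_W)(F_v)`, `k ↦ reindex e (k ⊗ 1_m)`** — the first member of the dual pair
`U(J_V) × U(J_W) → U(J_V ⊗ J_W)` at the place `v` restricted to `U(J_V) × 1`. [cite: MoeglinVignerasWaldspurger1987, Chap. 1 I.17]
[cite: GelbartRogawski1991, §3.2 p. 457] -/
def kronOneInl (N m : ℕ) {n : ℕ} (e : Fin N × Fin m ≃ Fin n) {F : Type} [Field F] [NumberField F] [Algebra F E]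
    (c : E ≃ₐ[F] E) (JV : Matrix (Fin N) (Fin N) E) (JW : Matrix (Fin m) (Fin m) E) (v : HeightOneSpectrum (𝓞 F)) :
    localPi E c N JV v →* localPi E c n (Matrix.reindex e e (JV ⊗ₖ JW)) v :=
  ((kronOneGL E N m e v).comp (localPi E c N JV v).subtype).codRestrict _ fun k => kronOneGL_mem E N m e c JV JW v k

/-- underlying family of `kronOneInl v k`. [cite: MoeglinVignerasWaldspurger1987, Chap. 1 I.17] -/
@[simp] theorem coe_kronOneInl (N m : ℕ) {n : ℕ} (e : Fin N × Fin m ≃ Fin n) {F : Type} [Field F] [NumberField F] [Algebra F E]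
    (c : E ≃ₐ[F] E) (JV : Matrix (Fin N) (Fin N) E) (JW : Matrix (Fin m) (Fin m) E) (v : HeightOneSpectrum (𝓞 F))
    (k : localPi E c N JV v) :
    ((kronOneInl E N m e c JV JW v k : localPi E c n (Matrix.reindex e e (JV ⊗ₖ JW)) v) : LocalGLPi E n v) =
      kronOneGL E N m e v (k : LocalGLPi E N v) := rfl

/-- `k ↦ reindex e (k ⊗ 1_m)` is continuous on `U(J_V)(F_v)`. [cite: MoeglinVignerasWaldspurger1987, Chap. 1 I.17] -/
theorem continuous_kronOneInl (N m : ℕ) {n : ℕ} (e : Fin N × Fin m ≃ Fin n) {F : Type} [Field F] [NumberField F] [Algebra F E]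
    (c : E ≃ₐ[F] E) (JV : Matrix (Fin N) (Fin N) E) (JW : Matrix (Fin m) (Fin m) E) (v : HeightOneSpectrum (𝓞 F)) :
    Continuous (kronOneInl E N m e c JV JW v) :=
  Topology.IsInducing.subtypeVal.continuous_iff.2 ((continuous_kronOneGL E N m e v).comp continuous_subtype_val)

end KronOne

/-! ## §2 The Kronecker embedding `ι = kronLoc : U(W ⊕ −W)(F_v) →* U(V ⊕ −V)(F_v)`, `h ↦ h ⊗ 1_V` -/

section Doubled

variable (F : Type) [Field F] [NumberField F] (E : Type) [Field E] [NumberField E] [Algebra F E]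
  [Algebra.IsQuadraticExtension F E] (c : E ≃ₐ[F] E)
  {δ : E} (hcδ : c δ = -δ) (hδ : δ ≠ 0) {d : F} (hd : δ * δ = algebraMap F E d)
  (v : HeightOneSpectrum (𝓞 F)) (m : ℕ) {T : Matrix (Fin m) (Fin m) F} (hT : T.IsSymm)
  {J : Matrix (Fin m) (Fin m) E} (hJ : J = T.map (algebraMap F E))
  {JD : Matrix (Fin (m + m)) (Fin (m + m)) E} (hJD : JD = (gramD F m T).map (algebraMap F E))
  (h1 : (1 : Matrix (Fin 1) (Fin 1) F).IsSymm)
  {JD₁ : Matrix (Fin (1 + 1)) (Fin (1 + 1)) E} (hJD₁ : JD₁ = (gramD F 1 1).map (algebraMap F E))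
-- (`kronLoc` re-binds `hJ hJD hJD₁` explicitly so that the definition's signature carries them.)

omit [Algebra.IsQuadraticExtension F E] in
include hJ hJD hJD₁ in
/-- **`U(reindex (J^𝔻_1 ⊗ₖ J))(F_v) = U(J^𝔻)(F_v)`** — the two doubled Gram matrices coincide (`reindex_eKron_gramD_one_kronecker`).
[cite: Kudla1984, §1] [cite: Kudla1994, §2] -/
theorem localPi_reindex_eKron_kronecker_eq :
    localPi E c (m + m) (Matrix.reindex (eKron m) (eKron m) (JD₁ ⊗ₖ J)) v = localPi E c (m + m) JD v := by
  rw [hJD₁, hJ, hJD, reindex_eKron_gramD_one_kronecker]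

/-- **THE KRONECKER EMBEDDING `ι : U(W ⊕ −W)(F_v) →* U(V ⊕ −V)(F_v)`, `h ↦ h ⊗ₖ 1_V`** (`V ⊕ −V = (W ⊕ −W) ⊗ V`; `kronOneInl` at
`e = eKron m`, `J_V = J^𝔻_1`, `J_W = J`, read on `U(J^𝔻)(F_v)` through `localPi_reindex_eKron_kronecker_eq`). [cite: Kudla1984, §1]
[cite: MoeglinVignerasWaldspurger1987, Chap. 1 I.17] -/
def kronLoc (hJ : J = T.map (algebraMap F E)) (hJD : JD = (gramD F m T).map (algebraMap F E))
    (hJD₁ : JD₁ = (gramD F 1 1).map (algebraMap F E)) : localPi E c (1 + 1) JD₁ v →* localPi E c (m + m) JD v :=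
  (MulEquiv.subgroupCongr (localPi_reindex_eKron_kronecker_eq F E c v m hJ hJD hJD₁)).toMonoidHom.comp
    (kronOneInl E (1 + 1) m (eKron m) c JD₁ J v)

omit [Algebra.IsQuadraticExtension F E] in
/-- underlying family of `ι h`: `(reindex (eKron m) (h_w ⊗ₖ 1_m))_w`. [cite: Kudla1984, §1] -/
theorem kronLoc_apply (h : localPi E c (1 + 1) JD₁ v) (w : PlacesOver E v) :
    ((kronLoc F E c v m hJ hJD hJD₁ h : localPi E c (m + m) JD v) : LocalGLPi E (m + m) v) w =
      UnitaryGroup.reindexGL (eKron m) (kroneckerGL ((h : LocalGLPi E (1 + 1) v) w, (1 : GL (Fin m) (w.1.adicCompletion E)))) :=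
  rfl

omit [Algebra.IsQuadraticExtension F E] in
/-- **components of `ι h`**: the matrix of `(ι h)_w` is `reindex (eKron m) (h_w ⊗ₖ 1_m)`. [cite: Kudla1984, §1] -/
theorem coe_kronLoc_apply (h : localPi E c (1 + 1) JD₁ v) (w : PlacesOver E v) :
    ((((kronLoc F E c v m hJ hJD hJD₁ h : localPi E c (m + m) JD v) : LocalGLPi E (m + m) v) w :
        GL (Fin (m + m)) (w.1.adicCompletion E)) : Matrix (Fin (m + m)) (Fin (m + m)) (w.1.adicCompletion E)) =
      Matrix.reindex (eKron m) (eKron m)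
        ((((h : LocalGLPi E (1 + 1) v) w : GL (Fin (1 + 1)) (w.1.adicCompletion E)) :
            Matrix (Fin (1 + 1)) (Fin (1 + 1)) (w.1.adicCompletion E)) ⊗ₖ (1 : Matrix (Fin m) (Fin m) (w.1.adicCompletion E))) := by
  rw [kronLoc_apply, UnitaryGroup.coe_reindexGL, coe_kroneckerGL, Units.val_one]

omit [Algebra.IsQuadraticExtension F E] in
/-- **the `e₂ m`-blocks of `ι h`**: `fromBlocks (h₀₀ • 1) (h₀₁ • 1) (h₁₀ • 1) (h₁₁ • 1)`, `h_{bb′}` the entries of `h_w` in the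
`e₂ 1`-enumeration. [cite: Kudla1994, §2] -/
theorem reindex_symm_kronLoc (h : localPi E c (1 + 1) JD₁ v) (w : PlacesOver E v) :
    Matrix.reindex (e₂ m).symm (e₂ m).symm
        ((((kronLoc F E c v m hJ hJD hJD₁ h : localPi E c (m + m) JD v) : LocalGLPi E (m + m) v) w :
            GL (Fin (m + m)) (w.1.adicCompletion E)) : Matrix (Fin (m + m)) (Fin (m + m)) (w.1.adicCompletion E)) =
      Matrix.fromBlocks
        ((((h : LocalGLPi E (1 + 1) v) w : GL (Fin (1 + 1)) (w.1.adicCompletion E)) : Matrix _ _ (w.1.adicCompletion E))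
            (e₂ 1 (Sum.inl 0)) (e₂ 1 (Sum.inl 0)) • (1 : Matrix (Fin m) (Fin m) (w.1.adicCompletion E)))
        ((((h : LocalGLPi E (1 + 1) v) w : GL (Fin (1 + 1)) (w.1.adicCompletion E)) : Matrix _ _ (w.1.adicCompletion E))
            (e₂ 1 (Sum.inl 0)) (e₂ 1 (Sum.inr 0)) • (1 : Matrix (Fin m) (Fin m) (w.1.adicCompletion E)))
        ((((h : LocalGLPi E (1 + 1) v) w : GL (Fin (1 + 1)) (w.1.adicCompletion E)) : Matrix _ _ (w.1.adicCompletion E))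
            (e₂ 1 (Sum.inr 0)) (e₂ 1 (Sum.inl 0)) • (1 : Matrix (Fin m) (Fin m) (w.1.adicCompletion E)))
        ((((h : LocalGLPi E (1 + 1) v) w : GL (Fin (1 + 1)) (w.1.adicCompletion E)) : Matrix _ _ (w.1.adicCompletion E))
            (e₂ 1 (Sum.inr 0)) (e₂ 1 (Sum.inr 0)) • (1 : Matrix (Fin m) (Fin m) (w.1.adicCompletion E))) := by
  rw [coe_kronLoc_apply, reindex_eKron_kronecker, ← Matrix.reindex_symm, Equiv.symm_apply_apply]

omit [Algebra.IsQuadraticExtension F E] in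
/-- `ι` is continuous. [cite: MoeglinVignerasWaldspurger1987, Chap. 1 I.17] -/
theorem continuous_kronLoc : Continuous (kronLoc F E c v m hJ hJD hJD₁) :=
  Topology.IsInducing.subtypeVal.continuous_iff.2
    (show Continuous (fun h => ((kronLoc F E c v m hJ hJD hJD₁ h : localPi E c (m + m) JD v) : LocalGLPi E (m + m) v)) from
      (continuous_kronOneGL E (1 + 1) m (eKron m) v).comp continuous_subtype_val)

/-! ## §3 Siegel compatibility: `deltaBlock`, `detDelta`, `IsSiegelDelta` under `ι` -/

omit [Algebra.IsQuadraticExtension F E] in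
/-- **the `Δ`-block of `ι h` is the scalar `h₀₀ + h₀₁`**: `deltaBlock (ι h) = (h₀₀ + h₀₁) • 1_m`. [cite: Kudla1994, §3] -/
theorem deltaBlock_kronLoc (w : PlacesOver E v) (h : localPi E c (1 + 1) JD₁ v) :
    deltaBlock F E c v m w (kronLoc F E c v m hJ hJD hJD₁ h) =
      ((((h : LocalGLPi E (1 + 1) v) w : GL (Fin (1 + 1)) (w.1.adicCompletion E)) : Matrix _ _ (w.1.adicCompletion E))
            (e₂ 1 (Sum.inl 0)) (e₂ 1 (Sum.inl 0)) +
          (((h : LocalGLPi E (1 + 1) v) w : GL (Fin (1 + 1)) (w.1.adicCompletion E)) : Matrix _ _ (w.1.adicCompletion E))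
            (e₂ 1 (Sum.inl 0)) (e₂ 1 (Sum.inr 0))) • (1 : Matrix (Fin m) (Fin m) (w.1.adicCompletion E)) := by
  simp only [deltaBlock, reindex_symm_kronLoc, Matrix.toBlocks_fromBlocks₁₁, Matrix.toBlocks_fromBlocks₁₂, add_smul]

omit [Algebra.IsQuadraticExtension F E] in
/-- **in rank one the `Δ`-block is the `1 × 1` matrix `(h₀₀ + h₀₁)`**. [cite: Kudla1994, §3] -/
theorem deltaBlock_one_apply (w : PlacesOver E v) (h : localPi E c (1 + 1) JD₁ v) (i j : Fin 1) :
    deltaBlock F E c v 1 w h i j =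
      (((h : LocalGLPi E (1 + 1) v) w : GL (Fin (1 + 1)) (w.1.adicCompletion E)) : Matrix _ _ (w.1.adicCompletion E))
          (e₂ 1 (Sum.inl 0)) (e₂ 1 (Sum.inl 0)) +
        (((h : LocalGLPi E (1 + 1) v) w : GL (Fin (1 + 1)) (w.1.adicCompletion E)) : Matrix _ _ (w.1.adicCompletion E))
          (e₂ 1 (Sum.inl 0)) (e₂ 1 (Sum.inr 0)) := by
  rw [Subsingleton.elim i 0, Subsingleton.elim j 0]
  simp only [deltaBlock, Matrix.add_apply, Matrix.toBlocks₁₁, Matrix.toBlocks₁₂, Matrix.of_apply, Matrix.reindex_apply,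
    Matrix.submatrix_apply, Equiv.symm_symm]

omit [Algebra.IsQuadraticExtension F E] in
/-- **`det_Δ h = h₀₀ + h₀₁` in rank one**, in the entries of the `w`-component (the `matS`-currency twin is ★ `detDelta_one_eq` of
`LocalDoubledSiegelParabolicBorelTransport`). [cite: Kudla1994, §3] [cite: HarrisKudlaSweet1996, §1 (1.15)] -/
theorem detDelta_one_eq_entries (w : PlacesOver E v) (h : localPi E c (1 + 1) JD₁ v) :
    detDelta F E c v 1 w h =
      (((h : LocalGLPi E (1 + 1) v) w : GL (Fin (1 + 1)) (w.1.adicCompletion E)) : Matrix _ _ (w.1.adicCompletion E))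
          (e₂ 1 (Sum.inl 0)) (e₂ 1 (Sum.inl 0)) +
        (((h : LocalGLPi E (1 + 1) v) w : GL (Fin (1 + 1)) (w.1.adicCompletion E)) : Matrix _ _ (w.1.adicCompletion E))
          (e₂ 1 (Sum.inl 0)) (e₂ 1 (Sum.inr 0)) := by
  rw [detDelta, Matrix.det_fin_one, deltaBlock_one_apply]

omit [Algebra.IsQuadraticExtension F E] in
/-- **`det_Δ (ι h) = (det_Δ h) ^ m`** (`det ((h₀₀ + h₀₁) • 1_m) = (h₀₀ + h₀₁)^m`): the `P_Δ`-character `|det_Δ|^s` of `H` restricts along `ι`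
to `|det_Δ|^{m s}` on `P_Δ(G₁)`. [cite: Kudla1994, §3] [cite: HarrisKudlaSweet1996, §1 (1.15)–(1.16)] -/
theorem detDelta_kronLoc (w : PlacesOver E v) (h : localPi E c (1 + 1) JD₁ v) :
    detDelta F E c v m w (kronLoc F E c v m hJ hJD hJD₁ h) = (detDelta F E c v 1 w h) ^ m := by
  rw [detDelta, deltaBlock_kronLoc, detDelta_one_eq_entries, Matrix.det_smul, Matrix.det_one, mul_one, Fintype.card_fin]

/-- the four `e₂ 1`-blocks of a rank-one doubled matrix are the `1 × 1` matrices of its entries: the block condition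
`h₁₁ + h₁₂ = h₂₁ + h₂₂` of ★ `isSiegelDelta_iff_blocks` in rank one is the scalar identity `h₀₀ + h₀₁ = h₁₀ + h₁₁` on the `w`-components
(the `matS`-currency twin is ★ `isSiegelDelta_one_iff` of `LocalDoubledSiegelParabolicBorelTransport`). [cite: Kudla1994, §3] -/
theorem isSiegelDelta_one_iff_entries (h : localPi E c (1 + 1) JD₁ v) :
    IsSiegelDelta F E c hcδ hδ hd v 1 h1 hJD₁ h ↔ ∀ w : PlacesOver E v,
      (((h : LocalGLPi E (1 + 1) v) w : GL (Fin (1 + 1)) (w.1.adicCompletion E)) : Matrix _ _ (w.1.adicCompletion E))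
            (e₂ 1 (Sum.inl 0)) (e₂ 1 (Sum.inl 0)) +
          (((h : LocalGLPi E (1 + 1) v) w : GL (Fin (1 + 1)) (w.1.adicCompletion E)) : Matrix _ _ (w.1.adicCompletion E))
            (e₂ 1 (Sum.inl 0)) (e₂ 1 (Sum.inr 0)) =
        (((h : LocalGLPi E (1 + 1) v) w : GL (Fin (1 + 1)) (w.1.adicCompletion E)) : Matrix _ _ (w.1.adicCompletion E))
            (e₂ 1 (Sum.inr 0)) (e₂ 1 (Sum.inl 0)) +
          (((h : LocalGLPi E (1 + 1) v) w : GL (Fin (1 + 1)) (w.1.adicCompletion E)) : Matrix _ _ (w.1.adicCompletion E))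
            (e₂ 1 (Sum.inr 0)) (e₂ 1 (Sum.inr 0)) := by
  rw [isSiegelDelta_iff_blocks]
  refine forall_congr' fun w => ?_
  rw [← Matrix.ext_iff]
  simp only [Fin.forall_fin_one, Matrix.add_apply, Matrix.toBlocks₁₁, Matrix.toBlocks₁₂, Matrix.toBlocks₂₁, Matrix.toBlocks₂₂,
    Matrix.of_apply, Matrix.reindex_apply, Matrix.submatrix_apply, Equiv.symm_symm, Fin.isValue]

/-- **`ι h ∈ P_Δ(H) ↔ h ∈ P_Δ(G₁)`** for `m ≠ 0` (`(h₀₀ + h₀₁) • 1_m = (h₁₀ + h₁₁) • 1_m ↔ h₀₀ + h₀₁ = h₁₀ + h₁₁`): the Siegel parabolics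
correspond under `ι` (`(W ⊕ −W) ⊗ V ⊇ Δ_W ⊗ V = Δ_V`). [cite: Kudla1994, §3] [cite: HarrisKudlaSweet1996, §1 (1.11)] -/
theorem isSiegelDelta_kronLoc_iff (hm : m ≠ 0) (h : localPi E c (1 + 1) JD₁ v) :
    IsSiegelDelta F E c hcδ hδ hd v m hT hJD (kronLoc F E c v m hJ hJD hJD₁ h) ↔ IsSiegelDelta F E c hcδ hδ hd v 1 h1 hJD₁ h := by
  rw [isSiegelDelta_iff_blocks, isSiegelDelta_one_iff_entries]
  refine forall_congr' fun w => ?_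
  simp only [reindex_symm_kronLoc, Matrix.toBlocks_fromBlocks₁₁, Matrix.toBlocks_fromBlocks₁₂, Matrix.toBlocks_fromBlocks₂₁,
    Matrix.toBlocks_fromBlocks₂₂, ← add_smul]
  refine ⟨fun hw => ?_, fun hw => by rw [hw]⟩
  have i₀ : Fin m := ⟨0, Nat.pos_of_ne_zero hm⟩
  have := congrFun (congrFun hw i₀) i₀
  simpa only [Matrix.smul_apply, Matrix.one_apply_eq, smul_eq_mul, mul_one] using this

variable {F E c hcδ hδ hd v m hT hJ hJD h1 hJD₁} in
/-- `ι` maps `P_Δ(G₁)` into `P_Δ(H)` (every `m`). [cite: Kudla1994, §3] -/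
theorem IsSiegelDelta.kronLoc {h : localPi E c (1 + 1) JD₁ v} (hh : IsSiegelDelta F E c hcδ hδ hd v 1 h1 hJD₁ h) :
    IsSiegelDelta F E c hcδ hδ hd v m hT hJD (kronLoc F E c v m hJ hJD hJD₁ h) := by
  rw [isSiegelDelta_iff_blocks]
  intro w
  have hw := ((isSiegelDelta_one_iff_entries F E c hcδ hδ hd v h1 hJD₁ h).1 hh) w
  simp only [reindex_symm_kronLoc, Matrix.toBlocks_fromBlocks₁₁, Matrix.toBlocks_fromBlocks₁₂, Matrix.toBlocks_fromBlocks₂₁,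
    Matrix.toBlocks_fromBlocks₂₂, ← add_smul, hw]

/-! ## §4 Compatibility with the block embeddings: `ι (z ⊕ z′) = (z·1_V) ⊕ (z′·1_V)` -/

omit [Algebra.IsQuadraticExtension F E] in
/-- **`ι (z ⊕ 1) = (z·1_V) ⊕ 1`**: on the first block `U(W)(F_v) ↪ U(W ⊕ −W)(F_v)` (★ `BlockSum.inlLoc`), `ι` is the local centre
`z ↦ z·1_V` of `U(V)(F_v)` (★ `localCenter`) followed by `U(V) ↪ U(V ⊕ V′)` — componentwise both are `reindex (z₀₀·1_m ⊕ 1_m)`.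
[cite: Kudla1984, §1] [cite: MoeglinVignerasWaldspurger1987, Chap. 1 I.17] -/
theorem kronLoc_inlLoc {T₁ T₂ : Matrix (Fin 1) (Fin 1) F} {J₁ : Matrix (Fin 1) (Fin 1) E}
    (hJ₁ : J₁ = T₁.map (algebraMap F E)) (hJD₁' : JD₁ = (UnitaryGroup.finSum 1 1 T₁ T₂).map (algebraMap F E)) (hJ₁0 : J₁ 0 0 ≠ 0)
    {T' : Matrix (Fin m) (Fin m) F} (hJD' : JD = (UnitaryGroup.finSum m m T T').map (algebraMap F E)) (z : localPi E c 1 J₁ v) :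
    kronLoc F E c v m hJ hJD hJD₁ (BlockSum.inlLoc F E c v 1 1 hJ₁ hJD₁' z) =
      BlockSum.inlLoc F E c v m m hJ hJD' (localCenter E c m J J₁ hJ₁0 v z) := by
  refine Subtype.ext (funext fun w => Units.ext ?_)
  rw [coe_kronLoc_apply, BlockSum.inlLoc_apply, BlockSum.inlLoc_apply, UnitaryGroup.coe_reindexGL, UnitaryGroup.coe_blockDiagGL,
    UnitaryGroup.coe_reindexGL, UnitaryGroup.coe_blockDiagGL, Units.val_one, Units.val_one, coe_localCenter, coe_localScalarGL_apply,
    reindex_eKron_kronecker]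
  simp only [Matrix.reindex_apply, Matrix.submatrix_apply, Equiv.symm_apply_apply, Matrix.fromBlocks_apply₁₁, Matrix.fromBlocks_apply₁₂,
    Matrix.fromBlocks_apply₂₁, Matrix.fromBlocks_apply₂₂, Matrix.zero_apply, Matrix.one_apply_eq, zero_smul, one_smul]

omit [Algebra.IsQuadraticExtension F E] in
/-- **`ι (1 ⊕ z′) = 1 ⊕ (z′·1_V)`**: on the second block `U(−W)(F_v) ↪ U(W ⊕ −W)(F_v)` (★ `BlockSum.inrLoc`), `ι` is the local centre of
`U(−V)(F_v)` followed by `U(V′) ↪ U(V ⊕ V′)`. [cite: Kudla1984, §1] [cite: MoeglinVignerasWaldspurger1987, Chap. 1 I.17] -/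
theorem kronLoc_inrLoc {T₁ T₂ : Matrix (Fin 1) (Fin 1) F} {J₂ : Matrix (Fin 1) (Fin 1) E}
    (hJ₂ : J₂ = T₂.map (algebraMap F E)) (hJD₁' : JD₁ = (UnitaryGroup.finSum 1 1 T₁ T₂).map (algebraMap F E)) (hJ₂0 : J₂ 0 0 ≠ 0)
    {T' : Matrix (Fin m) (Fin m) F} {J' : Matrix (Fin m) (Fin m) E} (hJ' : J' = T'.map (algebraMap F E))
    (hJD' : JD = (UnitaryGroup.finSum m m T T').map (algebraMap F E)) (z' : localPi E c 1 J₂ v) :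
    kronLoc F E c v m hJ hJD hJD₁ (BlockSum.inrLoc F E c v 1 1 hJ₂ hJD₁' z') =
      BlockSum.inrLoc F E c v m m hJ' hJD' (localCenter E c m J' J₂ hJ₂0 v z') := by
  refine Subtype.ext (funext fun w => Units.ext ?_)
  rw [coe_kronLoc_apply, BlockSum.inrLoc_apply, BlockSum.inrLoc_apply, UnitaryGroup.coe_reindexGL, UnitaryGroup.coe_blockDiagGL,
    UnitaryGroup.coe_reindexGL, UnitaryGroup.coe_blockDiagGL, Units.val_one, Units.val_one, coe_localCenter, coe_localScalarGL_apply,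
    reindex_eKron_kronecker]
  simp only [Matrix.reindex_apply, Matrix.submatrix_apply, Equiv.symm_apply_apply, Matrix.fromBlocks_apply₁₁, Matrix.fromBlocks_apply₁₂,
    Matrix.fromBlocks_apply₂₁, Matrix.fromBlocks_apply₂₂, Matrix.zero_apply, Matrix.one_apply_eq, zero_smul, one_smul]

omit [Algebra.IsQuadraticExtension F E] in
/-- **`ι (z ⊕ z′) = (z·1_V) ⊕ (z′·1_V)`**: `ι` carries the maximal torus `U(W) × U(−W) = E_v¹ × E_v¹` of `U(W ⊕ −W)(F_v)` onto the
product of the CENTRES `Z(U(V)) × Z(U(−V))` inside `U(V ⊕ −V)(F_v)` (so on product vectors `f₁ ⊠ f₂` of the doubled Weil representation it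
acts by the central characters of the two blocks). [cite: Kudla1984, §1] [cite: MoeglinVignerasWaldspurger1987, Chap. 1 I.17] -/
theorem kronLoc_inlLoc_mul_inrLoc {T₁ T₂ : Matrix (Fin 1) (Fin 1) F} {J₁ J₂ : Matrix (Fin 1) (Fin 1) E}
    (hJ₁ : J₁ = T₁.map (algebraMap F E)) (hJ₂ : J₂ = T₂.map (algebraMap F E))
    (hJD₁' : JD₁ = (UnitaryGroup.finSum 1 1 T₁ T₂).map (algebraMap F E)) (hJ₁0 : J₁ 0 0 ≠ 0) (hJ₂0 : J₂ 0 0 ≠ 0)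
    {T' : Matrix (Fin m) (Fin m) F} {J' : Matrix (Fin m) (Fin m) E} (hJ' : J' = T'.map (algebraMap F E))
    (hJD' : JD = (UnitaryGroup.finSum m m T T').map (algebraMap F E)) (z : localPi E c 1 J₁ v) (z' : localPi E c 1 J₂ v) :
    kronLoc F E c v m hJ hJD hJD₁ (BlockSum.inlLoc F E c v 1 1 hJ₁ hJD₁' z * BlockSum.inrLoc F E c v 1 1 hJ₂ hJD₁' z') =
      BlockSum.inlLoc F E c v m m hJ hJD' (localCenter E c m J J₁ hJ₁0 v z) *
        BlockSum.inrLoc F E c v m m hJ' hJD' (localCenter E c m J' J₂ hJ₂0 v z') := by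
  rw [map_mul, kronLoc_inlLoc F E c v m hJ hJD hJD₁ hJ₁ hJD₁' hJ₁0 hJD', kronLoc_inrLoc F E c v m hJ hJD hJD₁ hJ₂ hJD₁' hJ₂0 hJ' hJD']

/-! ## §5 `ι(G₁)` centralises the diagonal `U(V) ↪ U(V ⊕ −V)`, `g ↦ i(g, g)` (★ `diagD`): `(h ⊗ 1_V)(1 ⊗ g) = h ⊗ g = (1 ⊗ g)(h ⊗ 1_V)` -/

omit [Algebra.IsQuadraticExtension F E] in
/-- the diagonal `i(g,g)_w = reindex (e₂ m) (g_w ⊕ g_w)` IS the Kronecker matrix `reindex (eKron m) (1_{W ⊕ −W} ⊗ₖ g_w)`.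
[cite: Kudla1984, §1] [cite: Kudla1994, §2] -/
theorem reindex_e₂_fromBlocks_diag_eq_reindex_eKron {R : Type*} [CommRing R] (G : Matrix (Fin m) (Fin m) R) :
    Matrix.reindex (e₂ m) (e₂ m) (Matrix.fromBlocks G 0 0 G) =
      Matrix.reindex (eKron m) (eKron m) ((1 : Matrix (Fin (1 + 1)) (Fin (1 + 1)) R) ⊗ₖ G) := by
  have hne : e₂ 1 (Sum.inl 0) ≠ e₂ 1 (Sum.inr 0) := fun h => Sum.inl_ne_inr ((e₂ 1).injective h)
  rw [reindex_eKron_kronecker]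
  simp only [Matrix.one_apply_eq, Matrix.one_apply_ne hne, Matrix.one_apply_ne hne.symm, one_smul, zero_smul]

omit [Algebra.IsQuadraticExtension F E] in
/-- **`ι h` commutes with the diagonal `i(g, g)`** for every `h ∈ U(W ⊕ −W)(F_v)`, `g ∈ U(V)(F_v)` — the two members
`U(W ⊕ −W)` and `U(V)` of the see-saw pair inside `U((W ⊕ −W) ⊗ V)` commute (`(h ⊗ 1)(1 ⊗ g) = h ⊗ g = (1 ⊗ g)(h ⊗ 1)`).
[cite: Kudla1984, §1] [cite: MoeglinVignerasWaldspurger1987, Chap. 1 I.17] -/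
theorem kronLoc_mul_diagD_comm {J' : Matrix (Fin m) (Fin m) E} (hJ' : J' = (-T).map (algebraMap F E))
    (h : localPi E c (1 + 1) JD₁ v) (g : localPi E c m J v) :
    kronLoc F E c v m hJ hJD hJD₁ h * diagD F E c v m hJ hJ' hJD g = diagD F E c v m hJ hJ' hJD g * kronLoc F E c v m hJ hJD hJD₁ h := by
  refine Subtype.ext (funext fun w => Units.ext ?_)
  rw [Subgroup.coe_mul, Subgroup.coe_mul, Pi.mul_apply, Pi.mul_apply, Units.val_mul, Units.val_mul, coe_kronLoc_apply, diagD_apply,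
    reindex_e₂_fromBlocks_diag_eq_reindex_eKron, Matrix.reindex_apply, Matrix.reindex_apply, Matrix.submatrix_mul_equiv,
    Matrix.submatrix_mul_equiv, ← Matrix.mul_kronecker_mul, ← Matrix.mul_kronecker_mul, Matrix.mul_one, Matrix.one_mul, Matrix.mul_one,
    Matrix.one_mul]

end Doubled

/-! ## §6 (ED. 2) `ι` on the named elements of `G₁`: `matA (ι h) = blockInflate (matA h)`, `ι(w_Δ) = w_Δ`, `ι(n(t)) = n(t₀₀ · 1_V)`

The adapted-matrix dictionary (★ `LocalDoubledUnitaryLagrangians.matA`, ★ `LocalDoubledUnitaryIwahori.ofAdapted` ∕ `weylDelta`,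
★ `LocalDoubledUnitaryUnramifiedCell.nElem`): over `E ⊗ F_v` the matrix of `ι h` in the `e₂`-frame is the BLOCK INFLATION of the
`(1+1)`-matrix of `h` (each entry `a` becomes the scalar block `a · 1_m`); block inflation is multiplicative and carries the rank-one Cayley
frame `R₁ = [[1,1],[1,−1]]` to `R_m`, so it commutes with `adapt` and `ι` maps the rank-one Weyl element and Siegel unipotents to the
rank-`m` ones. -/

section Named

open Literature.NumberTheory.GelbartRogawski1991.AdaptedBlocks

/-- **block inflation**: the `(1+1)`-block matrix `a` with entries replaced by scalar `m × m` blocks. [cite: Kudla1984, §1] -/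
def blockInflate {R : Type*} [CommRing R] (m : ℕ) (a : Matrix (Fin 1 ⊕ Fin 1) (Fin 1 ⊕ Fin 1) R) :
    Matrix (Fin m ⊕ Fin m) (Fin m ⊕ Fin m) R :=
  Matrix.fromBlocks (a (Sum.inl 0) (Sum.inl 0) • (1 : Matrix (Fin m) (Fin m) R)) (a (Sum.inl 0) (Sum.inr 0) • (1 : Matrix (Fin m) (Fin m) R))
    (a (Sum.inr 0) (Sum.inl 0) • (1 : Matrix (Fin m) (Fin m) R)) (a (Sum.inr 0) (Sum.inr 0) • (1 : Matrix (Fin m) (Fin m) R))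

/-- block inflation of a block matrix of `1 × 1` blocks. [cite: Kudla1984, §1] -/
theorem blockInflate_fromBlocks {R : Type*} [CommRing R] (m : ℕ) (A B C D : Matrix (Fin 1) (Fin 1) R) :
    blockInflate m (Matrix.fromBlocks A B C D) =
      Matrix.fromBlocks (A 0 0 • (1 : Matrix (Fin m) (Fin m) R)) (B 0 0 • (1 : Matrix (Fin m) (Fin m) R))
        (C 0 0 • (1 : Matrix (Fin m) (Fin m) R)) (D 0 0 • (1 : Matrix (Fin m) (Fin m) R)) := by
  simp only [blockInflate, Matrix.fromBlocks_apply₁₁, Matrix.fromBlocks_apply₁₂, Matrix.fromBlocks_apply₂₁, Matrix.fromBlocks_apply₂₂]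

/-- block inflation is multiplicative. [cite: Kudla1984, §1] -/
theorem blockInflate_mul {R : Type*} [CommRing R] (m : ℕ) (a b : Matrix (Fin 1 ⊕ Fin 1) (Fin 1 ⊕ Fin 1) R) :
    blockInflate m (a * b) = blockInflate m a * blockInflate m b := by
  simp only [blockInflate, Matrix.fromBlocks_multiply, Matrix.smul_mul, Matrix.mul_smul, Matrix.one_mul, smul_smul, ← add_smul,
    Matrix.mul_apply, Fintype.sum_sum_type, Finset.univ_unique, Fin.default_eq_zero, Finset.sum_singleton]
  congr 2 <;> ring

/-- block inflation commutes with scalars. [cite: Kudla1984, §1] -/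
theorem blockInflate_smul {R : Type*} [CommRing R] (m : ℕ) (r : R) (a : Matrix (Fin 1 ⊕ Fin 1) (Fin 1 ⊕ Fin 1) R) :
    blockInflate m (r • a) = r • blockInflate m a := by
  simp only [blockInflate, Matrix.fromBlocks_smul, Matrix.smul_apply, smul_eq_mul, mul_smul]

/-- block inflation commutes with entrywise ring homomorphisms. [cite: Kudla1984, §1] -/
theorem blockInflate_map {R S : Type*} [CommRing R] [CommRing S] (f : R →+* S) (m : ℕ) (a : Matrix (Fin 1 ⊕ Fin 1) (Fin 1 ⊕ Fin 1) R) :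
    (blockInflate m a).map f = blockInflate m (a.map f) := by
  simp only [blockInflate, Matrix.fromBlocks_map, Matrix.map_apply]
  ext i j
  rcases i with i | i <;> rcases j with j | j <;>
    simp only [Matrix.fromBlocks_apply₁₁, Matrix.fromBlocks_apply₁₂, Matrix.fromBlocks_apply₂₁, Matrix.fromBlocks_apply₂₂,
      Matrix.map_apply, Matrix.smul_apply, Matrix.one_apply, smul_eq_mul, mul_ite, mul_one, mul_zero, apply_ite f, map_zero]

/-- **the Cayley frame inflates**: `blockInflate (R₁) = R_m` (`R = [[1, 1], [1, −1]]`, ★ `cayR`). [cite: HarrisKudlaSweet1996, §1 (1.11)] -/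
theorem blockInflate_cayR {R : Type*} [CommRing R] (m : ℕ) : blockInflate m (cayR R (Fin 1)) = cayR R (Fin m) := by
  rw [cayR, cayR, blockInflate_fromBlocks]
  simp only [Matrix.one_apply_eq, Matrix.neg_apply, one_smul, neg_smul]

/-- `blockInflate (R₁⁻¹) = R_m⁻¹` (★ `cayRinv = ⅟2 • cayR`). [cite: HarrisKudlaSweet1996, §1 (1.11)] -/
theorem blockInflate_cayRinv {R : Type*} [CommRing R] [Invertible (2 : R)] (m : ℕ) :
    blockInflate m (cayRinv R (Fin 1)) = cayRinv R (Fin m) := by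
  rw [cayRinv, cayRinv, blockInflate_smul, blockInflate_cayR]

/-- **block inflation commutes with the adapted frame**: `adapt (blockInflate a) = blockInflate (adapt a)`. [cite: Kudla1994, §3] -/
theorem adapt_blockInflate {R : Type*} [CommRing R] [Invertible (2 : R)] (m : ℕ) (a : Matrix (Fin 1 ⊕ Fin 1) (Fin 1 ⊕ Fin 1) R) :
    adapt (blockInflate m a) = blockInflate m (adapt a) := by
  rw [adapt, adapt, blockInflate_mul, blockInflate_mul, blockInflate_cayR, blockInflate_cayRinv]

variable (F : Type) [Field F] [NumberField F] (E : Type) [Field E] [NumberField E] [Algebra F E]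
  [Algebra.IsQuadraticExtension F E] (c : E ≃ₐ[F] E)
  {δ : E} (hcδ : c δ = -δ) (hδ : δ ≠ 0) {d : F} (hd : δ * δ = algebraMap F E d)
  (v : HeightOneSpectrum (𝓞 F)) (m : ℕ) {T : Matrix (Fin m) (Fin m) F} (hT : T.IsSymm)
  {J : Matrix (Fin m) (Fin m) E} (hJ : J = T.map (algebraMap F E))
  {JD : Matrix (Fin (m + m)) (Fin (m + m)) E} (hJD : JD = (gramD F m T).map (algebraMap F E))
  {JD₁ : Matrix (Fin (1 + 1)) (Fin (1 + 1)) E} (hJD₁ : JD₁ = (gramD F 1 1).map (algebraMap F E))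

omit [Algebra.IsQuadraticExtension F E] in
/-- the entries of the rank-one adapted matrix `matA h` at a place `w` are the `e₂ 1`-entries of `h_w`. [cite: Kudla1994, §3] -/
theorem matA_one_apply_apply (h : localPi E c (1 + 1) JD₁ v) (i j : Fin 1 ⊕ Fin 1) (w : PlacesOver E v) :
    matA F E c v 1 h i j w =
      (((h : LocalGLPi E (1 + 1) v) w : GL (Fin (1 + 1)) (w.1.adicCompletion E)) : Matrix _ _ (w.1.adicCompletion E)) (e₂ 1 i) (e₂ 1 j) := by
  rw [coe_component_eq_matS_map]
  simp only [matA, Matrix.reindex_apply, Matrix.submatrix_apply, Equiv.symm_symm, Matrix.map_apply, Pi.evalRingHom_apply]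

omit [Algebra.IsQuadraticExtension F E] in
/-- **`matA (ι h) = blockInflate (matA h)`**: over `E ⊗ F_v` the `e₂`-frame matrix of `ι h = h ⊗ 1_V` is the block inflation of that of `h`.
[cite: Kudla1984, §1] [cite: Kudla1994, §3] -/
theorem matA_kronLoc (h : localPi E c (1 + 1) JD₁ v) :
    matA F E c v m (kronLoc F E c v m hJ hJD hJD₁ h) = blockInflate m (matA F E c v 1 h) := by
  rw [Matrix.eq_iff_forall_map_evalRingHom]
  intro w
  rw [blockInflate_map, matA, UnitaryGroup.reindex_map, ← coe_component_eq_matS_map, reindex_symm_kronLoc, blockInflate]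
  simp only [Matrix.map_apply, Pi.evalRingHom_apply, matA_one_apply_apply]

omit [Algebra.IsQuadraticExtension F E] in
/-- `adapt (matA (ι h)) = blockInflate (adapt (matA h))` — the ADAPTED matrix of `ι h` is the block inflation of that of `h`.
[cite: Kudla1994, §3] -/
theorem adapt_matA_kronLoc (h : localPi E c (1 + 1) JD₁ v) :
    adapt (matA F E c v m (kronLoc F E c v m hJ hJD hJD₁ h)) = blockInflate m (adapt (matA F E c v 1 h)) := by
  rw [matA_kronLoc, adapt_blockInflate]

omit [Algebra.IsQuadraticExtension F E] in
/-- **`ι (w_Δ) = w_Δ`**: the Kronecker embedding carries the rank-one Weyl element (adapted matrix `[[0,1],[1,0]]`, ★ `weylDelta`) to the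
rank-`m` one. [cite: Kudla1994, §3] [cite: Weil1964, n° 32] -/
theorem kronLoc_weylDelta :
    kronLoc F E c v m hJ hJD hJD₁ (weylDelta F E c v 1 hJD₁ (T₀ := 1)) = weylDelta F E c v m hJD (T₀ := T) := by
  apply matA_injective F E c v m
  rw [matA_kronLoc, weylDelta, weylDelta, matA_ofAdapted, matA_ofAdapted, blockInflate_mul, blockInflate_mul, blockInflate_cayR,
    blockInflate_cayRinv, blockInflate_fromBlocks]
  simp only [Matrix.zero_apply, Matrix.one_apply_eq, zero_smul, one_smul]

omit [Algebra.IsQuadraticExtension F E] in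
/-- **`ι (n(t)) = n(t₀₀ · 1_V)`**: the Kronecker embedding carries the rank-one Siegel unipotent with adapted matrix `[[1, t], [0, 1]]` (★ `nElem`)
to the rank-`m` Siegel unipotent with parameter the scalar matrix `t₀₀ · 1_m`. [cite: Kudla1994, §3] [cite: Weil1964, n° 32] -/
theorem kronLoc_nElem (t : Matrix (Fin 1) (Fin 1) (LocalRing E v))
    (ht : (t.map (conjLocal E c v))ᵀ * gramS F E v 1 (1 : Matrix (Fin 1) (Fin 1) F) + gramS F E v 1 (1 : Matrix (Fin 1) (Fin 1) F) * t = 0)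
    (ht' : ((t 0 0 • (1 : Matrix (Fin m) (Fin m) (LocalRing E v))).map (conjLocal E c v))ᵀ * gramS F E v m T +
      gramS F E v m T * (t 0 0 • (1 : Matrix (Fin m) (Fin m) (LocalRing E v))) = 0) :
    kronLoc F E c v m hJ hJD hJD₁ (nElem F E c v 1 hJD₁ t ht) = nElem F E c v m hJD (t 0 0 • 1) ht' := by
  apply matA_injective F E c v m
  rw [matA_kronLoc, nElem, nElem, matA_ofAdapted, matA_ofAdapted, blockInflate_mul, blockInflate_mul, blockInflate_cayR,
    blockInflate_cayRinv, blockInflate_fromBlocks]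
  simp only [Matrix.zero_apply, Matrix.one_apply_eq, zero_smul, one_smul]

end Named

end Literature.NumberTheory.GelbartRogawski1991.UnitaryDualPair.LocalSplitting

end
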